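import Summits.Ventures.CertifiedManyBodySolver.Certificates.HubbardSquare_n7o8_TKT_polChord_kernelQuad_farUray_floorU4
import Summits.Ventures.CertifiedManyBodySolver.Certificates.HubbardSquare_U4_n7o8_lower_row544
import HarnessLib

/-! # The #544 far-ray rows on the SIGNED node BY NAME («29/100 ∀ U ≥ 12.9», «2/7 ∀ U ≥ 13.6» at (U, ⅞, 0); K3-free; kernel quadrature).

Three-line instances of the rows of `HubbardSquare_n7o8_TKT_polChord_kernelQuad_farUray_floorU4` (which take the
CERTIFIED #544 floor `e₀(4, ⅞, 0) ≥ −327366541277305701986689/2⁷⁸` as a hypothesis `hfloor`) on the landed node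
`cert_r544_…_uprime` of `HubbardSquare_U4_n7o8_lower_row544`, whose body is that hypothesis verbatim.
No new number; bookkeeping only (hubbard-tc RULING R82). -/

noncomputable section
namespace Summit.Ventures.CertifiedManyBodySolver.Certificates
open Literature.MathematicalPhysics.QuantumLattice Literature.MathematicalPhysics.StatisticalMechanics.KosterlitzThouless
open Summit.Ventures.CertifiedManyBodySolver.Observables

/-- **ROW «∀ U ≥ 129/10: T_KT(U,⅞,0) ≤ 29/100·t» on CERTIFIED #544 BY NAME.** [cite: HazraVermaRanderia2019, eqs. (2)–(4)] [cite: NelsonKosterlitz1977, eq. (1)] -/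
theorem tKT_n7o8_tp0_le_29o100_r544_kernelQuad_polChord_b100o29_of_le_129o10 {U : ℝ} (hU : 129 / 10 ≤ U) (h544 : cert_r544_bs_GU4n7o8tp0_w3_b4_R2_ob5p2_kry1_kry2c3rel_hanK7B4D4_KN4_PR20d4_hanK8c2s_uprime)
    {ρe : ℝ → ℝ} {Tc : ℝ} (hT : ThermalKTDictionaryAt 0 U (7 / 8) ρe Tc) : Tc ≤ 29 / 100 :=
  tKT_n7o8_tp0_le_29o100_floor544_kernelQuad_polChord_b100o29_of_le_129o10 hU h544 hT

/-- **ROW «∀ U ≥ 68/5: T_KT(U,⅞,0) ≤ 2/7·t» on CERTIFIED #544 BY NAME.** [cite: HazraVermaRanderia2019, eqs. (2)–(4)] [cite: NelsonKosterlitz1977, eq. (1)] -/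
theorem tKT_n7o8_tp0_le_2o7_r544_kernelQuad_polChord_b7o2_of_le_68o5 {U : ℝ} (hU : 68 / 5 ≤ U) (h544 : cert_r544_bs_GU4n7o8tp0_w3_b4_R2_ob5p2_kry1_kry2c3rel_hanK7B4D4_KN4_PR20d4_hanK8c2s_uprime)
    {ρe : ℝ → ℝ} {Tc : ℝ} (hT : ThermalKTDictionaryAt 0 U (7 / 8) ρe Tc) : Tc ≤ 2 / 7 :=
  tKT_n7o8_tp0_le_2o7_floor544_kernelQuad_polChord_b7o2_of_le_68o5 hU h544 hT

/-- Decimal print of the row above: **∀ U ≥ 68/5: T_KT(U,⅞,0) ≤ 0.2858·t** on CERTIFIED #544 BY NAME. [cite: HazraVermaRanderia2019, eqs. (2)–(4)] [cite: NelsonKosterlitz1977, eq. (1)] -/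
theorem tKT_n7o8_tp0_le_decimal_r544_kernelQuad_polChord_b7o2_of_le_68o5 {U : ℝ} (hU : 68 / 5 ≤ U) (h544 : cert_r544_bs_GU4n7o8tp0_w3_b4_R2_ob5p2_kry1_kry2c3rel_hanK7B4D4_KN4_PR20d4_hanK8c2s_uprime)
    {ρe : ℝ → ℝ} {Tc : ℝ} (hT : ThermalKTDictionaryAt 0 U (7 / 8) ρe Tc) : Tc ≤ (0.2858 : ℝ) :=
  tKT_n7o8_tp0_le_decimal_floor544_kernelQuad_polChord_b7o2_of_le_68o5 hU h544 hT

end Summit.Ventures.CertifiedManyBodySolver.Certificates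
end
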